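import Mathlib
import Summits.Ventures.PercRepro2.Defs
import Summits.Ventures.PercRepro2.Graph

/-!
# The one-colour-separated switch, and `m9` for pendant marks (blind cell PercRepro2, p3 g15,
2026-08-27; `proofs/P3-CPNC.md` §8)

For a 2-colouring of the edges of a finite multigraph — the configuration `ω` (the `Y`-colour) and
its complement `compl ω` (the `W`-colour) — and marks `p, q, r, s`, the switching move `m9` of row
2′CSW compares `#{p ~_Y q, r ~_Y s, Sep}` with `#{p ~_Y q, r ~_W s, Sep}`, `Sep` = «`{p,q}` and `{r,s}`
separated in BOTH colours» (`TypedSwitchingPrimed.typedCount_m9_iff_primed`).  Proved here: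
(1) the version with only the separation IN THE COLOUR OF THE SECOND EVENT on each side,
`#{p ~_Y q, r ~_Y s, {p,q} ≁_Y {r,s}} ≤ #{p ~_Y q, r ~_W s, {p,q} ≁_W {r,s}}`
(`card_leftSet_le_card_rightSet`), by the cluster switch `ω ↦ ω ⊕ (edges touching C_Y(r))`
(`switch`): `p ~_Y q` survives because its witness path avoids `C_Y(r)` (`conn_switch_of_notMem`),
`r ~_W s` holds because the interior is flipped (`conn_compl_switch_of_mem`), and the `W`-cluster of
`r` in the image is EXACTLY the old `Y`-cluster (`cluster_compl_switch`), which makes the map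
injective (`switch_injective`); (2) `m9` itself, in primed and in sign form, when `r` and `s` are
PENDANT (`card_m9Left_le_card_m9Right_of_pendant`, `m9SignSum_nonpos_of_pendant`): the switch then
keeps the `Y`-separation too (`r`, `s` lose their only edge and are `Y`-isolated in the image); for
general `r, s` it fails exactly on the defect set `Λ` of `proofs/P3-M9.md` §3.  Own work; std axioms.
-/

namespace Summit.Ventures.PercRepro2

namespace OneColourSwitch

open Finset Classical

variable {V : Type*} {E : Type*}
variable (ends : E → Sym2 V)

/-- The complementary configuration: the `W`-colour class of the 2-colouring `ω`. -/
def compl (ω : Config E) : Config E := fun e => !ω e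

omit ends in
/-- `compl` is an involution. -/
@[simp] lemma compl_compl (ω : Config E) : compl (compl ω) = ω := by
  funext e; simp [compl]

/-- Flip the colour of every edge touching the vertex set `S`. -/
noncomputable def flipTouch (S : Set V) (ω : Config E) : Config E :=
  fun e => if e ∈ touches ends S then !ω e else ω e

/-- `flipTouch` on an edge touching `S`. -/
lemma flipTouch_of_mem {S : Set V} {ω : Config E} {e : E} (h : e ∈ touches ends S) :
    flipTouch ends S ω e = !ω e := by
  simp [flipTouch, h]

/-- `flipTouch` on an edge not touching `S`. -/
lemma flipTouch_of_notMem {S : Set V} {ω : Config E} {e : E} (h : e ∉ touches ends S) :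
    flipTouch ends S ω e = ω e := by
  simp [flipTouch, h]

/-- `flipTouch S` is an involution. -/
lemma flipTouch_flipTouch (S : Set V) (ω : Config E) :
    flipTouch ends S (flipTouch ends S ω) = ω := by
  funext e
  by_cases h : e ∈ touches ends S
  · rw [flipTouch_of_mem ends h, flipTouch_of_mem ends h, Bool.not_not]
  · rw [flipTouch_of_notMem ends h, flipTouch_of_notMem ends h]

/-- The one-colour separation: neither `p` nor `q` is joined to `r` or `s`. -/
def sepY (p q r s : V) (ω : Config E) : Prop :=
  ¬ Conn ends ω p r ∧ ¬ Conn ends ω p s ∧ ¬ Conn ends ω q r ∧ ¬ Conn ends ω q s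

/-- The left set of the switch: `p ~_Y q`, `r ~_Y s`, `Y`-separated. -/
def leftSet (p q r s : V) : Set (Config E) :=
  {ω | Conn ends ω p q ∧ Conn ends ω r s ∧ sepY ends p q r s ω}

/-- The right set of the switch: `p ~_Y q`, `r ~_W s`, `W`-separated. -/
def rightSet (p q r s : V) : Set (Config E) :=
  {ω | Conn ends ω p q ∧ Conn ends (compl ω) r s ∧ sepY ends p q r s (compl ω)}

/-- The switch: flip every edge touching the `Y`-cluster of `r`. -/
noncomputable def switch (r : V) (ω : Config E) : Config E :=
  flipTouch ends (cluster ends ω r) ω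

section Lemmas

variable {ends}

/-- The complement of the switch agrees with `ω` on the edges touching the cluster of `r`. -/
lemma compl_switch_of_mem {r : V} {ω : Config E} {e : E} (h : e ∈ touches ends (cluster ends ω r)) :
    compl (switch ends r ω) e = ω e := by
  simp [compl, switch, flipTouch_of_mem ends h]

/-- The switch agrees with `ω` off the edges touching the cluster of `r`. -/
lemma switch_of_notMem {r : V} {ω : Config E} {e : E} (h : e ∉ touches ends (cluster ends ω r)) :
    switch ends r ω e = ω e :=
  flipTouch_of_notMem ends h

/-- An open edge with an endpoint in a cluster has its other endpoint in the cluster. -/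
lemma mem_cluster_of_openEdge {r : V} {ω : Config E} {e : E} {x y : V} (he : ω e = true)
    (hends : ends e = s(x, y)) (hx : x ∈ cluster ends ω r) : y ∈ cluster ends ω r :=
  conn_trans hx (conn_of_openAdj ⟨e, he, hends⟩)

/-- **`p ~ q` survives the switch** when `p` is outside the cluster of `r`: the connections of `p`
only use edges not touching the cluster, which the switch leaves alone. -/
lemma conn_switch_of_notMem {r p q : V} {ω : Config E} (hp : p ∉ cluster ends ω r)
    (h : Conn ends ω p q) : Conn ends (switch ends r ω) p q := by
  have key : q ∈ {x | x ∉ cluster ends ω r ∧ Conn ends (switch ends r ω) p x} := by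
    refine mem_of_conn_of_closed (ends := ends) (ω := ω) ?_ ⟨hp, conn_refl _ _ _⟩ h
    rintro x ⟨hxK, hxc⟩ y hxy
    obtain ⟨_, e, he, hends⟩ := openGraph_adj.1 hxy
    have hyK : y ∉ cluster ends ω r := by
      intro hy
      exact hxK (mem_cluster_of_openEdge he (by rw [hends, Sym2.eq_swap]) hy)
    have hnt : e ∉ touches ends (cluster ends ω r) := by
      rintro ⟨x', hx', y', hends'⟩
      rw [hends, Sym2.eq_iff] at hends'
      rcases hends' with ⟨rfl, _⟩ | ⟨_, rfl⟩
      · exact hxK hx'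
      · exact hyK hx'
    have he' : switch ends r ω e = true := by rw [switch_of_notMem hnt]; exact he
    exact ⟨hyK, conn_trans hxc (conn_of_openAdj ⟨e, he', hends⟩)⟩
  exact key.2

/-- **The cluster is `W`-connected after the switch**: every vertex of `C_Y(r)` is joined to `r` in
the complement of the switched configuration (the interior edges of the cluster are flipped). -/
lemma conn_compl_switch_of_mem {r u : V} {ω : Config E} (hu : u ∈ cluster ends ω r) :
    Conn ends (compl (switch ends r ω)) r u := by
  have key : u ∈ {x | x ∈ cluster ends ω r ∧ Conn ends (compl (switch ends r ω)) r x} := by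
    refine mem_of_conn_of_closed (ends := ends) (ω := ω) ?_
      ⟨mem_cluster_self ends ω r, conn_refl _ _ _⟩ hu
    rintro x ⟨hxK, hxc⟩ y hxy
    obtain ⟨_, e, he, hends⟩ := openGraph_adj.1 hxy
    have ht : e ∈ touches ends (cluster ends ω r) := mem_touches_of_ends hends (Or.inl hxK)
    have he' : compl (switch ends r ω) e = true := by rw [compl_switch_of_mem ht]; exact he
    exact ⟨mem_cluster_of_openEdge he hends hxK, conn_trans hxc (conn_of_openAdj ⟨e, he', hends⟩)⟩
  exact key.2

/-- **The `W`-cluster of `r` after the switch stays inside `C_Y(r)`**: its boundary edges are flipped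
to `Y`, so no `W`-edge leaves it. -/
lemma mem_cluster_of_conn_compl_switch {r u : V} {ω : Config E}
    (h : Conn ends (compl (switch ends r ω)) r u) : u ∈ cluster ends ω r := by
  refine mem_of_conn_of_closed (ends := ends) (ω := compl (switch ends r ω)) ?_
    (mem_cluster_self ends ω r) h
  intro x hxK y hxy
  obtain ⟨_, e, he, hends⟩ := openGraph_adj.1 hxy
  have ht : e ∈ touches ends (cluster ends ω r) := mem_touches_of_ends hends (Or.inl hxK)
  have he' : ω e = true := by rw [← compl_switch_of_mem ht]; exact he
  exact mem_cluster_of_openEdge he' hends hxK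

/-- **The `W`-cluster of `r` after the switch is exactly the old `Y`-cluster.** -/
lemma cluster_compl_switch (r : V) (ω : Config E) :
    cluster ends (compl (switch ends r ω)) r = cluster ends ω r :=
  Set.Subset.antisymm (fun _ hu => mem_cluster_of_conn_compl_switch hu)
    (fun _ hu => conn_compl_switch_of_mem hu)

/-- The switch maps the left set into the right set. -/
lemma switch_mem_rightSet {p q r s : V} {ω : Config E} (hω : ω ∈ leftSet ends p q r s) :
    switch ends r ω ∈ rightSet ends p q r s := by
  obtain ⟨hpq, hrs, hpr, hps, hqr, hqs⟩ := hω
  have hpK : p ∉ cluster ends ω r := fun h => hpr (conn_symm h)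
  have hqK : q ∉ cluster ends ω r := fun h => hqr (conn_symm h)
  have hrs' : Conn ends (compl (switch ends r ω)) r s := conn_compl_switch_of_mem hrs
  refine ⟨conn_switch_of_notMem hpK hpq, hrs', ?_, ?_, ?_, ?_⟩
  · exact fun h => hpK (mem_cluster_of_conn_compl_switch (conn_symm h))
  · exact fun h => hpK (mem_cluster_of_conn_compl_switch (conn_trans hrs' (conn_symm h)))
  · exact fun h => hqK (mem_cluster_of_conn_compl_switch (conn_symm h))
  · exact fun h => hqK (mem_cluster_of_conn_compl_switch (conn_trans hrs' (conn_symm h)))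

/-- The switch is injective (everywhere, in fact): the cluster is read off the image. -/
lemma switch_injective (r : V) : Function.Injective (switch ends r) := by
  intro ω ω' h
  have hK : cluster ends ω r = cluster ends ω' r := by
    rw [← cluster_compl_switch (ends := ends) r ω, ← cluster_compl_switch (ends := ends) r ω', h]
  have h1 : ω = flipTouch ends (cluster ends ω r) (switch ends r ω) :=
    (flipTouch_flipTouch ends _ ω).symm
  have h2 : ω' = flipTouch ends (cluster ends ω' r) (switch ends r ω') :=
    (flipTouch_flipTouch ends _ ω').symm
  rw [h1, h2, hK, h]

end Lemmas

section Count

variable [Fintype E] [DecidableEq E]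

/-- **The one-colour-separated switch.**  For every finite multigraph and marks `p, q, r, s`:
`#{ω : p ~_Y q, r ~_Y s, {p,q} ≁_Y {r,s}} ≤ #{ω : p ~_Y q, r ~_W s, {p,q} ≁_W {r,s}}`
(`W` = the complement of `ω`).  The injection is the cluster switch `ω ↦ ω ⊕ touches (C_Y(r))`. -/
theorem card_leftSet_le_card_rightSet (p q r s : V) :
    (univ.filter (fun ω : Config E => ω ∈ leftSet ends p q r s)).card ≤
      (univ.filter (fun ω : Config E => ω ∈ rightSet ends p q r s)).card := by
  apply Finset.card_le_card_of_injOn (switch ends r)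
  · intro ω hω
    simp only [coe_filter, mem_univ, true_and, Set.mem_setOf_eq] at hω ⊢
    exact switch_mem_rightSet hω
  · exact (switch_injective (ends := ends) r).injOn

/-- The same inequality as a sum of indicators (the weight-free count of the two events). -/
theorem sum_leftSet_le_sum_rightSet (p q r s : V) :
    (∑ ω : Config E, if ω ∈ leftSet ends p q r s then (1 : ℕ) else 0) ≤
      ∑ ω : Config E, if ω ∈ rightSet ends p q r s then (1 : ℕ) else 0 := by
  rw [← Finset.card_filter, ← Finset.card_filter]
  exact card_leftSet_le_card_rightSet ends p q r s

end Count


/-! ## `m9′` for pendant `r, s` (`proofs/P3-CPNC.md` §8c) -/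

/-- The two-colour separation of `m9`: `{p,q}` separated from `{r,s}` in `ω` and in `compl ω`. -/
def sep2 (p q r s : V) (ω : Config E) : Prop :=
  sepY ends p q r s ω ∧ sepY ends p q r s (compl ω)

/-- The left set of `m9′`: `Sep`, `p ~_Y q`, `r ~_Y s`. -/
def m9Left (p q r s : V) : Set (Config E) :=
  {ω | sep2 ends p q r s ω ∧ Conn ends ω p q ∧ Conn ends ω r s}

/-- The right set of `m9′`: `Sep`, `p ~_Y q`, `r ~_W s`. -/
def m9Right (p q r s : V) : Set (Config E) :=
  {ω | sep2 ends p q r s ω ∧ Conn ends ω p q ∧ Conn ends (compl ω) r s}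

/-- `r` is pendant with the single edge `e₁`: every edge at `r` is `e₁`, and `e₁ = {r, v}`. -/
def Pendant (r : V) (e₁ : E) : Prop :=
  (∀ e, r ∈ ends e → e = e₁) ∧ ∃ v, v ≠ r ∧ ends e₁ = s(r, v)

section Lemmas

variable {ends}

/-- A vertex with no open edge is joined only to itself. -/
lemma eq_of_conn_of_no_openEdge {ω : Config E} {r x : V}
    (hr : ∀ e, r ∈ ends e → ω e = false) (h : Conn ends ω x r) : x = r := by
  have key : x ∈ {y | y = r} := by
    refine mem_of_conn_of_closed (ends := ends) (ω := ω) ?_ rfl (conn_symm h)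
    rintro y rfl z hyz
    obtain ⟨_, e, he, hends⟩ := openGraph_adj.1 hyz
    have : ω e = false := hr e (by rw [hends]; exact Sym2.mem_mk_left _ _)
    rw [this] at he
    exact absurd he (by decide)
  exact key

/-- In the switched configuration a pendant mark `r ∈ C_Y(r)` with its edge open in `ω` has no open
edge (its only edge was flipped). -/
lemma switch_no_openEdge_of_pendant {r : V} {e₁ : E} {ω : Config E} (hp : Pendant ends r e₁)
    (hrs : ω e₁ = true) : ∀ e, r ∈ ends e → switch ends r ω e = false := by
  intro e he
  have : e = e₁ := hp.1 e he
  subst this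
  have ht : e ∈ touches ends (cluster ends ω r) := by
    obtain ⟨v, _, hv⟩ := hp.2
    exact mem_touches_of_ends hv (Or.inl (mem_cluster_self ends ω r))
  rw [switch, flipTouch_of_mem ends ht, hrs]
  rfl

/-- The only edge of a pendant mark is open when the mark is joined to any other vertex. -/
lemma open_of_conn_of_pendant {r x : V} {e₁ : E} {ω : Config E} (hp : Pendant ends r e₁)
    (hx : x ≠ r) (h : Conn ends ω r x) : ω e₁ = true := by
  by_contra hne
  have hne' : ω e₁ = false := by simpa using hne
  have hr : ∀ e, r ∈ ends e → ω e = false := fun e he => by rw [hp.1 e he]; exact hne'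
  exact hx (eq_of_conn_of_no_openEdge hr (conn_symm h))

/-- A pendant `s` (edge `e₂`) lies in the cluster of any vertex it is joined to; its edge is then
in `touches (C_Y(r))` whenever `s ∈ C_Y(r)`. -/
lemma switch_no_openEdge_of_pendant' {r s : V} {e₂ : E} {ω : Config E} (hp : Pendant ends s e₂)
    (hs : s ∈ cluster ends ω r) (hsr : s ≠ r) : ∀ e, s ∈ ends e → switch ends r ω e = false := by
  intro e he
  have : e = e₂ := hp.1 e he
  subst this
  have hopen : ω e = true := open_of_conn_of_pendant hp hsr.symm (conn_symm hs)
  have ht : e ∈ touches ends (cluster ends ω r) := by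
    obtain ⟨v, _, hv⟩ := hp.2
    exact mem_touches_of_ends hv (Or.inl hs)
  rw [switch, flipTouch_of_mem ends ht, hopen]
  rfl

/-- The switch maps the `m9′` left set into the `m9′` right set when `r` and `s` are pendant. -/
lemma switch_mem_m9Right_of_pendant {p q r s : V} {e₁ e₂ : E} (hr : Pendant ends r e₁)
    (hs : Pendant ends s e₂) (hpr : p ≠ r) (hps : p ≠ s) (hqr : q ≠ r) (hqs : q ≠ s) (hrs : r ≠ s)
    {ω : Config E} (hω : ω ∈ m9Left ends p q r s) : switch ends r ω ∈ m9Right ends p q r s := by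
  obtain ⟨⟨hY, _⟩, hpq, hrsc⟩ := hω
  have hleft : ω ∈ leftSet ends p q r s := ⟨hpq, hrsc, hY⟩
  obtain ⟨hpq', hrs', hW⟩ := switch_mem_rightSet hleft
  -- `r` and `s` have no open edge in the switched configuration
  have hr0 : ∀ e, r ∈ ends e → switch ends r ω e = false :=
    switch_no_openEdge_of_pendant hr (open_of_conn_of_pendant hr hrs.symm hrsc)
  have hs0 : ∀ e, s ∈ ends e → switch ends r ω e = false :=
    switch_no_openEdge_of_pendant' hs hrsc hrs.symm
  refine ⟨⟨⟨?_, ?_, ?_, ?_⟩, hW⟩, hpq', hrs'⟩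
  · exact fun h => hpr (eq_of_conn_of_no_openEdge hr0 h)
  · exact fun h => hps (eq_of_conn_of_no_openEdge hs0 h)
  · exact fun h => hqr (eq_of_conn_of_no_openEdge hr0 h)
  · exact fun h => hqs (eq_of_conn_of_no_openEdge hs0 h)

end Lemmas

section Count

variable [Fintype E] [DecidableEq E]

/-- **`m9′` for pendant `r, s`.**  If `r` and `s` are pendant (single edges `e₁`, `e₂`) and distinct
from each other and from `p, q`, then
`#{Sep, p ~_Y q, r ~_Y s} ≤ #{Sep, p ~_Y q, r ~_W s}` — the primed form of the switching move `m9`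
(`TypedSwitchingPrimed.typedCount_m9_iff_primed`), here for the weight-free 2-colouring count. -/
theorem card_m9Left_le_card_m9Right_of_pendant {p q r s : V} {e₁ e₂ : E} (hr : Pendant ends r e₁)
    (hs : Pendant ends s e₂) (hpr : p ≠ r) (hps : p ≠ s) (hqr : q ≠ r) (hqs : q ≠ s) (hrs : r ≠ s) :
    (univ.filter (fun ω : Config E => ω ∈ m9Left ends p q r s)).card ≤
      (univ.filter (fun ω : Config E => ω ∈ m9Right ends p q r s)).card := by
  apply Finset.card_le_card_of_injOn (switch ends r)
  · intro ω hω
    simp only [coe_filter, mem_univ, true_and, Set.mem_setOf_eq] at hω ⊢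
    exact switch_mem_m9Right_of_pendant hr hs hpr hps hqr hqs hrs hω
  · exact (switch_injective (ends := ends) r).injOn

end Count


/-! ## The sign form of `m9` (`TypedSwitchingPrimed.typedCount_m9_iff_sign`): `Σ_Sep σ_pq σ_rs ≤ 0`,
equal to `2 · (#m9Left − #m9Right)` by the colour flip (`m9SignSum_eq`); the pendant class in that form. -/

section SignForm

variable [Fintype E] [DecidableEq E]

/-- The colour preference `σ_{ab} = 1[a ~_Y b] − 1[a ~_W b]` of a pair. -/
noncomputable def sigma (ω : Config E) (a b : V) : ℤ :=
  (if Conn ends ω a b then 1 else 0) - (if Conn ends (compl ω) a b then 1 else 0)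

/-- The `m9` sign-form sum `Σ_{Sep} σ_pq · σ_rs` (weight-free). -/
noncomputable def m9SignSum (p q r s : V) : ℤ :=
  ∑ ω : Config E, if sep2 ends p q r s ω then sigma ends ω p q * sigma ends ω r s else 0

variable {ends}

omit [Fintype E] [DecidableEq E] in
/-- The two-colour separation is invariant under the colour flip. -/
lemma sep2_compl {p q r s : V} {ω : Config E} : sep2 ends p q r s (compl ω) ↔ sep2 ends p q r s ω := by
  simp only [sep2, compl_compl]
  exact and_comm

omit [Fintype E] [DecidableEq E] in
/-- The pointwise expansion of the sign kernel into the four colour patterns. -/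
lemma sign_kernel_eq {p q r s : V} (ω : Config E) :
    (if sep2 ends p q r s ω then sigma ends ω p q * sigma ends ω r s else 0) =
      ((if sep2 ends p q r s ω ∧ Conn ends ω p q ∧ Conn ends ω r s then (1 : ℤ) else 0) -
        (if sep2 ends p q r s ω ∧ Conn ends ω p q ∧ Conn ends (compl ω) r s then 1 else 0)) -
      ((if sep2 ends p q r s ω ∧ Conn ends (compl ω) p q ∧ Conn ends ω r s then (1 : ℤ) else 0) -
        (if sep2 ends p q r s ω ∧ Conn ends (compl ω) p q ∧ Conn ends (compl ω) r s then 1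
          else 0)) := by
  unfold sigma
  by_cases h0 : sep2 ends p q r s ω <;> by_cases h1 : Conn ends ω p q <;>
    by_cases h2 : Conn ends (compl ω) p q <;> by_cases h3 : Conn ends ω r s <;>
    by_cases h4 : Conn ends (compl ω) r s <;> simp [h0, h1, h2, h3, h4]

/-- The colour flip as a permutation of the configurations. -/
def complPerm : Equiv.Perm (Config E) := Function.Involutive.toPerm compl compl_compl

/-- The two `W`-first pattern counts are the two `Y`-first ones, by the colour flip. -/
lemma sum_flip_pattern {p q r s : V} (A B A' B' : Config E → Prop)
    (hA : ∀ ω, A ω ↔ A' (compl ω)) (hB : ∀ ω, B ω ↔ B' (compl ω)) :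
    (∑ ω : Config E, if sep2 ends p q r s ω ∧ A ω ∧ B ω then (1 : ℤ) else 0) =
      ∑ ω : Config E, if sep2 ends p q r s ω ∧ A' ω ∧ B' ω then (1 : ℤ) else 0 := by
  refine Fintype.sum_equiv complPerm _ _ (fun ω => ?_)
  simp only [complPerm, Function.Involutive.coe_toPerm, sep2_compl, hA, hB]

/-- **The sign form is twice the primed difference** (the weight-free analogue of
`TypedSwitchingPrimed.typedCount_kerSign`). -/
theorem m9SignSum_eq (p q r s : V) :
    m9SignSum ends p q r s =
      2 * (((univ.filter (fun ω : Config E => ω ∈ m9Left ends p q r s)).card : ℤ) -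
        (univ.filter (fun ω : Config E => ω ∈ m9Right ends p q r s)).card) := by
  unfold m9SignSum
  simp only [sign_kernel_eq, Finset.sum_sub_distrib]
  have hWW := sum_flip_pattern (ends := ends) (p := p) (q := q) (r := r) (s := s)
    (fun ω => Conn ends (compl ω) p q) (fun ω => Conn ends (compl ω) r s)
    (fun ω => Conn ends ω p q) (fun ω => Conn ends ω r s)
    (fun ω => Iff.rfl) (fun ω => Iff.rfl)
  have hWY := sum_flip_pattern (ends := ends) (p := p) (q := q) (r := r) (s := s)
    (fun ω => Conn ends (compl ω) p q) (fun ω => Conn ends ω r s)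
    (fun ω => Conn ends ω p q) (fun ω => Conn ends (compl ω) r s)
    (fun ω => Iff.rfl) (fun ω => by rw [compl_compl])
  rw [hWW, hWY, Finset.sum_boole, Finset.sum_boole]
  simp only [m9Left, m9Right, Set.mem_setOf_eq]
  ring

/-- **`m9` in sign form for pendant `r, s`**: `Σ_{Sep} σ_pq · σ_rs ≤ 0`. -/
theorem m9SignSum_nonpos_of_pendant {p q r s : V} {e₁ e₂ : E} (hr : Pendant ends r e₁)
    (hs : Pendant ends s e₂) (hpr : p ≠ r) (hps : p ≠ s) (hqr : q ≠ r) (hqs : q ≠ s) (hrs : r ≠ s) :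
    m9SignSum ends p q r s ≤ 0 := by
  rw [m9SignSum_eq]
  have h := card_m9Left_le_card_m9Right_of_pendant (ends := ends) hr hs hpr hps hqr hqs hrs
  have h' : ((univ.filter (fun ω : Config E => ω ∈ m9Left ends p q r s)).card : ℤ) ≤
      (univ.filter (fun ω : Config E => ω ∈ m9Right ends p q r s)).card := by exact_mod_cast h
  linarith

end SignForm

end OneColourSwitch

end Summit.Ventures.PercRepro2
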